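import Mathlib
import Summits.MatrixMultiplication.MatrixMultiplication.Theses.FourierTwoFamiliesModP
import Summits.MatrixMultiplication.MatrixMultiplication.Theorems.PrimeTwoFamilies.Negative.Slices

/-!
# Crux `PrimeTwoFamilies` (stmt-MatrixMultiplication-14308), line `Sketch` — stub `stub_capacityTransfer`
# (siege k5/24, Mathlib-API route: `Nat.ofDigits` + Bertrand + `Filter.atTop` bookkeeping)

An independent, Mathlib-only proof of the registered stub `stub_capacityTransfer` of the capacity
line: CAPACITY GADGETS (a gadget of direct pairs `(P c, Q c)_{c<r}` in `ℤ/m` of co-volume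
`≥ m^{1-ε}` together with a zero-error code `W ⊆ (Fin L → Fin r)`, `|W| ≥ (m^L)^{1/2-ε}`) give every
slice `PrimeTwoFamiliesAt δ`, `0 < δ ≤ 1`, of the crux.

The proof does not use the tree's mixed-radix transfer (`exists_prime_sdpp_of_addEquiv` ←
`Literature…exists_freiman3_of_addEquiv`); the carry-free embedding is done with Mathlib's digit API:

* `lift_direct`, `lift_cross` — the CODE LIFT: the product blocks `∏ₜ P (w t)`, `∏ₜ Q (w t)`
  (`Fintype.piFinset`) of the words of a zero-error code satisfy clauses (W) and (X) of the route.
* `ofDigits_ofFn_add`, `digit_reflect`, `digit_lt` — the base-`2m` DIGIT MAP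
  `x ↦ Nat.ofDigits (2m) [val (x 0), …, val (x (L-1))]` on `Fin L → ℤ/m` reflects two-fold sums
  (`Nat.ofDigits_add_ofDigits_eq_ofDigits_zipWith_of_length_eq`, `Nat.ofDigits_inj_of_len_eq`: the
  digits of a two-fold sum are `≤ 2m - 2 < 2m`) and is `< (2m)^L` (`Nat.ofDigits_lt_base_pow_length`).
* `transfer` — reduce the digit map modulo a Bertrand prime `p ∈ (2(2m)^L, 4(2m)^L]`
  (`Nat.exists_prime_lt_and_le_two_mul`): still two-fold-sum reflecting, hence injective and
  carrying SDPP families to SDPP families of the same block sizes in `ℤ/p`.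
* `rpow_natCast_swap`, `bookkeeping` — the exponent bookkeeping, uniform in the word length `L ≥ 1`,
  phrased with `Filter.atTop` (`tendsto_rpow_atTop`, `filter_upwards`): with `ε = δ/16`, for all large `m`, a code of
  size `N ≥ (m^L)^{1/2-ε}` and a host `p ≤ 4(2m)^L` leave room for `n := max n₀ ⌈p^{1/(2+δ)}⌉₊` pairs:
  `n₀ ≤ n ≤ N`, `p ≤ n^{2+δ}`, `n^{2-δ} ≤ (m^{1-ε})^L`.
* `stub_capacityTransfer` — the registered stub, verbatim signature.

Helper file landed `--supports stmt-MatrixMultiplication-14308`; no new definitions.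
-/

-- single-conjunct summit: the mandated namespace `Summit.MatrixMultiplication.MatrixMultiplication.…`
-- repeats `MatrixMultiplication` (summit = sub-problem); the library sets this in the lakefile,
-- a standalone elaboration of this file does not.
set_option linter.dupNamespace false

namespace Summit.MatrixMultiplication.MatrixMultiplication.Theorems.PrimeTwoFamilies.CapacityTransferK5

open Finset Filter
open Summit.MatrixMultiplication.MatrixMultiplication.Theses
open Summit.MatrixMultiplication.MatrixMultiplication.Theorems.PrimeTwoFamilies.Negative

/-! ## The code lift (`Fintype.piFinset` blocks of code words) -/

/-- Clause (W) for a lifted block: if every letter `(P c, Q c)` is a direct pair, then for every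
word `w` the product block `(∏ₜ P (w t), ∏ₜ Q (w t))` is a direct pair (coordinatewise). -/
theorem lift_direct {K : Type*} [AddCommGroup K] [DecidableEq K] {r L : ℕ}
    {P Q : Fin r → Finset K}
    (hD : ∀ c : Fin r, ∀ x ∈ P c, ∀ x' ∈ P c, ∀ y ∈ Q c, ∀ y' ∈ Q c,
      (x - x') + (y - y') = 0 → x = x' ∧ y = y') (w : Fin L → Fin r) :
    ∀ a ∈ Fintype.piFinset fun t => P (w t), ∀ a' ∈ Fintype.piFinset fun t => P (w t),
    ∀ b ∈ Fintype.piFinset fun t => Q (w t), ∀ b' ∈ Fintype.piFinset fun t => Q (w t),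
      (a - a') + (b - b') = 0 → a = a' ∧ b = b' := by
  intro a ha a' ha' b hb b' hb' h
  rw [Fintype.mem_piFinset] at ha ha' hb hb'
  have key : ∀ t, a t = a' t ∧ b t = b' t := fun t =>
    hD (w t) (a t) (ha t) (a' t) (ha' t) (b t) (hb t) (b' t) (hb' t)
      (by have := congrFun h t; simpa using this)
  exact ⟨funext fun t => (key t).1, funext fun t => (key t).2⟩

/-- Clause (X) for lifted blocks: if the code words `i ≠ k` are strongly separated in some
coordinate `t` (every cross difference `Q (k t) - P (i t)` avoids every diagonal difference set
`Q c - P c`), then `(a - a') + (b - b') = 0` with `a ∈ ∏ P∘i`, `a' ∈ ∏ P∘j`, `b ∈ ∏ Q∘j`,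
`b' ∈ ∏ Q∘k` forces `i = k`: at the coordinate `t` the identity reads `b' t - a t = b t - a' t`,
a cross difference equal to a diagonal one. -/
theorem lift_cross {K : Type*} [AddCommGroup K] [DecidableEq K] {r L : ℕ}
    {P Q : Fin r → Finset K} {W : Finset (Fin L → Fin r)}
    (hC : ∀ i ∈ W, ∀ k ∈ W, i ≠ k → ∃ t : Fin L,
      ∀ x ∈ P (i t), ∀ y ∈ Q (k t), ∀ c : Fin r, ∀ x' ∈ P c, ∀ y' ∈ Q c, y - x ≠ y' - x')
    {i k : Fin L → Fin r} (hi : i ∈ W) (hk : k ∈ W) (j : Fin L → Fin r) :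
    ∀ a ∈ Fintype.piFinset fun t => P (i t), ∀ a' ∈ Fintype.piFinset fun t => P (j t),
    ∀ b ∈ Fintype.piFinset fun t => Q (j t), ∀ b' ∈ Fintype.piFinset fun t => Q (k t),
      (a - a') + (b - b') = 0 → i = k := by
  intro a ha a' ha' b hb b' hb' h
  rw [Fintype.mem_piFinset] at ha ha' hb hb'
  by_contra hik
  obtain ⟨t, ht⟩ := hC i hi k hk hik
  have key : (a t - a' t) + (b t - b' t) = 0 := by
    have := congrFun h t
    simpa using this
  have e : b t - a' t = b' t - a t := by
    rw [← sub_eq_zero, ← key]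
    abel
  exact ht (a t) (ha t) (b' t) (hb' t) (j t) (a' t) (ha' t) (b t) (hb t) e.symm

/-! ## The base-`2m` digit map on `Fin L → ℤ/m` -/

/-- Sums of numbers given by digit vectors of the same length are read off digitwise
(no normalisation of the digits is needed for `Nat.ofDigits`):
`Nat.ofDigits_add_ofDigits_eq_ofDigits_zipWith_of_length_eq`, and the `zipWith (· + ·)` of two
`List.ofFn` lists is the `List.ofFn` of the pointwise sum. -/
theorem ofDigits_ofFn_add (M : ℕ) {L : ℕ} (f g : Fin L → ℕ) :
    Nat.ofDigits M (List.ofFn f) + Nat.ofDigits M (List.ofFn g) =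
      Nat.ofDigits M (List.ofFn fun t => f t + g t) := by
  rw [Nat.ofDigits_add_ofDigits_eq_ofDigits_zipWith_of_length_eq (by simp)]
  congr 1
  apply List.ext_getElem
  · simp
  · intro i h₁ h₂
    simp

/-- The base-`2m` digit map `x ↦ Nat.ofDigits (2m) [val (x t)]ₜ` on `Fin L → ℤ/m` REFLECTS TWO-FOLD
SUMS: the digits `val (a t) + val (b t) ≤ 2m - 2 < 2m` of a two-fold sum determine it
(`Nat.ofDigits_inj_of_len_eq`), and they determine `a t + b t` in `ℤ/m`. -/
theorem digit_reflect {m L : ℕ} [NeZero m] (a b a' b' : Fin L → ZMod m)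
    (h : Nat.ofDigits (2 * m) (List.ofFn fun t => (a t).val) +
          Nat.ofDigits (2 * m) (List.ofFn fun t => (b t).val) =
        Nat.ofDigits (2 * m) (List.ofFn fun t => (a' t).val) +
          Nat.ofDigits (2 * m) (List.ofFn fun t => (b' t).val)) :
    a + b = a' + b' := by
  rw [ofDigits_ofFn_add, ofDigits_ofFn_add] at h
  have hm : 0 < m := Nat.pos_of_ne_zero (NeZero.ne m)
  have hdig : ∀ x y : Fin L → ZMod m,
      ∀ l ∈ List.ofFn (fun t => (x t).val + (y t).val), l < 2 * m := by
    intro x y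
    rw [List.forall_mem_ofFn_iff]
    intro t
    have := ZMod.val_lt (x t)
    have := ZMod.val_lt (y t)
    omega
  have hinj := Nat.ofDigits_inj_of_len_eq (by omega : 1 < 2 * m) (by simp) (hdig a b) (hdig a' b') h
  rw [List.ofFn_inj] at hinj
  funext t
  have ht : (a t).val + (b t).val = (a' t).val + (b' t).val := congrFun hinj t
  have hc : ((a t).val : ZMod m) + ((b t).val : ZMod m) =
      ((a' t).val : ZMod m) + ((b' t).val : ZMod m) := by
    rw [← Nat.cast_add, ← Nat.cast_add, ht]
  simpa only [ZMod.natCast_zmod_val, Pi.add_apply] using hc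

/-- The digit map takes values `< (2m)^L` (`Nat.ofDigits_lt_base_pow_length`). -/
theorem digit_lt {m L : ℕ} [NeZero m] (x : Fin L → ZMod m) :
    Nat.ofDigits (2 * m) (List.ofFn fun t => (x t).val) < (2 * m) ^ L := by
  have hm : 0 < m := Nat.pos_of_ne_zero (NeZero.ne m)
  have h := Nat.ofDigits_lt_base_pow_length (b := 2 * m) (l := List.ofFn fun t => (x t).val)
    (by omega) (by
      rw [List.forall_mem_ofFn_iff]
      intro t
      have := ZMod.val_lt (x t)
      omega)
  simpa only [List.length_ofFn] using h

/-! ## Transfer into a prime cyclic host -/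

/-- **Carry-free transfer into a Bertrand prime.**  SDPP families `(A i, B i)_{i<n}` in
`Fin L → ℤ/m` (`m ≥ 1`) move into `ℤ/p` for some prime `p ≤ 4 (2m)^L` with all block sizes kept:
reduce the base-`2m` digit map modulo a prime `p ∈ (2 (2m)^L, 4 (2m)^L]`
(`Nat.exists_prime_lt_and_le_two_mul`); two-fold sums are `< p`, so the reduced map still reflects
two-fold sums, hence is injective and preserves clauses (W) and (X) on images. -/
theorem transfer {m L n : ℕ} [NeZero m] {A B : Fin n → Finset (Fin L → ZMod m)}
    (hW : ∀ i : Fin n, ∀ a ∈ A i, ∀ a' ∈ A i, ∀ b ∈ B i, ∀ b' ∈ B i,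
      (a - a') + (b - b') = 0 → a = a' ∧ b = b')
    (hX : ∀ i j k : Fin n, ∀ a ∈ A i, ∀ a' ∈ A j, ∀ b ∈ B j, ∀ b' ∈ B k,
      (a - a') + (b - b') = 0 → i = k) :
    ∃ p : ℕ, p.Prime ∧ p ≤ 4 * (2 * m) ^ L ∧ ∃ A' B' : Fin n → Finset (ZMod p),
      (∀ i, (A' i).card = (A i).card ∧ (B' i).card = (B i).card) ∧
      (∀ i : Fin n, ∀ a ∈ A' i, ∀ a' ∈ A' i, ∀ b ∈ B' i, ∀ b' ∈ B' i,
        (a - a') + (b - b') = 0 → a = a' ∧ b = b') ∧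
      (∀ i j k : Fin n, ∀ a ∈ A' i, ∀ a' ∈ A' j, ∀ b ∈ B' j, ∀ b' ∈ B' k,
        (a - a') + (b - b') = 0 → i = k) := by
  classical
  -- the digit map and a Bertrand prime above all of its two-fold sums
  set ψ : (Fin L → ZMod m) → ℕ := fun x => Nat.ofDigits (2 * m) (List.ofFn fun t => (x t).val)
  have hψlt : ∀ x, ψ x < (2 * m) ^ L := fun x => digit_lt x
  have hpow : 0 < (2 * m) ^ L := pow_pos (by have := NeZero.ne m; omega) L
  obtain ⟨p, hp, hltp, hple⟩ := Nat.exists_prime_lt_and_le_two_mul (2 * (2 * m) ^ L) (by omega)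
  let φ : (Fin L → ZMod m) → ZMod p := fun x => ((ψ x : ℕ) : ZMod p)
  have h2 : ∀ a b, ψ a + ψ b < p := fun a b => by
    have := hψlt a
    have := hψlt b
    omega
  have hφ : ∀ a b a' b', φ a + φ b = φ a' + φ b' → a + b = a' + b' := by
    intro a b a' b' h
    have h' : ((ψ a + ψ b : ℕ) : ZMod p) = ((ψ a' + ψ b' : ℕ) : ZMod p) := by
      push_cast
      exact h
    rw [ZMod.natCast_eq_natCast_iff', Nat.mod_eq_of_lt (h2 _ _), Nat.mod_eq_of_lt (h2 _ _)] at h'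
    exact digit_reflect a b a' b' h'
  have hsub : ∀ a a' b b', (φ a - φ a') + (φ b - φ b') = 0 → (a - a') + (b - b') = 0 := by
    intro a a' b b' h
    rw [sub_add_sub_comm, sub_eq_zero] at h ⊢
    exact hφ _ _ _ _ h
  have hinj : Function.Injective φ := fun a a' h =>
    add_right_cancel (hφ a a a' a (by rw [h]))
  refine ⟨p, hp, by omega, fun i => (A i).image φ, fun i => (B i).image φ,
    fun i => ⟨card_image_of_injective _ hinj, card_image_of_injective _ hinj⟩, ?_, ?_⟩
  · intro i x hx x' hx' y hy y' hy' he
    obtain ⟨a, ha, rfl⟩ := mem_image.1 hx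
    obtain ⟨a', ha', rfl⟩ := mem_image.1 hx'
    obtain ⟨b, hb, rfl⟩ := mem_image.1 hy
    obtain ⟨b', hb', rfl⟩ := mem_image.1 hy'
    obtain ⟨rfl, rfl⟩ := hW i a ha a' ha' b hb b' hb' (hsub _ _ _ _ he)
    exact ⟨rfl, rfl⟩
  · intro i j k x hx x' hx' y hy y' hy' he
    obtain ⟨a, ha, rfl⟩ := mem_image.1 hx
    obtain ⟨a', ha', rfl⟩ := mem_image.1 hx'
    obtain ⟨b, hb, rfl⟩ := mem_image.1 hy
    obtain ⟨b', hb', rfl⟩ := mem_image.1 hy'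
    exact hX i j k a ha a' ha' b hb b' hb' (hsub _ _ _ _ he)

/-! ## Exponent bookkeeping (filters at `atTop`, uniform in the word length) -/

/-- Exchanging a natural and a real exponent: `(x^e)^L = (x^L)^e` for `x ≥ 0`. -/
theorem rpow_natCast_swap {x : ℝ} (hx : 0 ≤ x) (e : ℝ) (L : ℕ) :
    (x ^ e) ^ L = (x ^ (L : ℝ)) ^ e := by
  rw [← Real.rpow_natCast, ← Real.rpow_mul hx, ← Real.rpow_mul hx, mul_comm]

/-- **Bookkeeping, uniform in `L`.**  For `0 < δ ≤ 1` and every `n₀`: for all sufficiently large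
levels `m`, every word length `L ≥ 1`, every code size `N ≥ (m^L)^{1/2-δ/16}` and every host size
`p ≤ 4 (2m)^L` admit a number `n` of pairs with `n₀ ≤ n ≤ N`, `p ≤ n^{2+δ}` and
`n^{2-δ} ≤ (m^{1-δ/16})^L`.  Choice: `n := max n₀ ⌈p^{1/(2+δ)}⌉₊`; with `X := m^L ≥ m` and
`8 ≤ m^{δ/16}` one has `4 (2m)^L ≤ 8^L m^L ≤ X^{1+δ/16}`, so `n ≤ 2 X^{(1+δ/16)/(2+δ)} ≤ X^{1/2-δ/16}`
by the exponent gap `(1+δ/16)/(2+δ) < 1/2 - δ/16` (`δ < 5`), and finally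
`n^{2-δ} ≤ X^{(1/2-δ/16)(2-δ)} ≤ X^{1-δ/16}`.  The three largeness conditions on `m` are
`Filter.Eventually` facts at `atTop` (`tendsto_rpow_atTop`, `Filter.Tendsto.eventually_ge_atTop`). -/
theorem bookkeeping {δ : ℝ} (hδ : 0 < δ) (hδ1 : δ ≤ 1) (n₀ : ℕ) :
    ∀ᶠ m : ℕ in atTop, ∀ L : ℕ, 1 ≤ L →
      ∀ N : ℕ, ((m : ℝ) ^ (L : ℝ)) ^ (1 / 2 - δ / 16) ≤ (N : ℝ) →
      ∀ p : ℕ, p ≤ 4 * (2 * m) ^ L →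
        ∃ n : ℕ, n₀ ≤ n ∧ n ≤ N ∧ (p : ℝ) ≤ (n : ℝ) ^ (2 + δ) ∧
          (n : ℝ) ^ (2 - δ) ≤ ((m : ℝ) ^ (1 - δ / 16)) ^ L := by
  have h2δ : (0 : ℝ) < 2 + δ := by linarith
  -- the exponent gap behind `n ≤ N`, and the exponent inequality behind the co-volume bound
  have hgap : 0 < 1 / 2 - δ / 16 - (1 + δ / 16) / (2 + δ) := by
    rw [sub_pos, div_lt_iff₀ h2δ]
    nlinarith
  have hexp₂ : (1 / 2 - δ / 16) * (2 - δ) ≤ 1 - δ / 16 := by nlinarith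
  -- positive real powers of naturals are eventually above any constant
  have hev : ∀ (C : ℝ) {e : ℝ}, 0 < e → ∀ᶠ m : ℕ in atTop, C ≤ (m : ℝ) ^ e := fun C e he =>
    ((tendsto_rpow_atTop he).comp tendsto_natCast_atTop_atTop).eventually_ge_atTop C
  filter_upwards [hev 8 (show (0 : ℝ) < δ / 16 by positivity), hev 2 hgap,
    hev (n₀ : ℝ) (show (0 : ℝ) < 1 / 2 - δ / 16 by linarith), eventually_ge_atTop 1]
    with m h8 h2 hn₀ hm1
  intro L hL N hN p hp
  have hm1R : (1 : ℝ) ≤ m := by exact_mod_cast hm1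
  have hm0R : (0 : ℝ) ≤ m := zero_le_one.trans hm1R
  -- the real size `X = m ^ L ≥ m` of the lifted host
  set X : ℝ := (m : ℝ) ^ (L : ℝ) with hX
  have hXdef : X = (m : ℝ) ^ L := Real.rpow_natCast _ _
  have hmX : (m : ℝ) ≤ X := by
    rw [hXdef]
    exact le_self_pow₀ hm1R (by omega)
  have hX1 : 1 ≤ X := hm1R.trans hmX
  have hX0 : 0 < X := one_pos.trans_le hX1
  have hmono : ∀ {e : ℝ}, 0 ≤ e → (m : ℝ) ^ e ≤ X ^ e := fun he => Real.rpow_le_rpow hm0R hmX he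
  -- `p ≤ X ^ (1 + δ/16)`
  have hpX : (p : ℝ) ≤ X ^ (1 + δ / 16) := by
    have h1 : (p : ℝ) ≤ 4 * (2 * (m : ℝ)) ^ L := by exact_mod_cast hp
    have h4 : (4 : ℝ) ≤ 4 ^ L := le_self_pow₀ (by norm_num) (by omega)
    have h2' : (4 : ℝ) * (2 * (m : ℝ)) ^ L ≤ 8 ^ L * (m : ℝ) ^ L := by
      calc (4 : ℝ) * (2 * (m : ℝ)) ^ L = 4 * 2 ^ L * (m : ℝ) ^ L := by rw [mul_pow, mul_assoc]
        _ ≤ 4 ^ L * 2 ^ L * (m : ℝ) ^ L := by gcongr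
        _ = 8 ^ L * (m : ℝ) ^ L := by rw [← mul_pow]; norm_num
    have h3 : (8 : ℝ) ^ L ≤ X ^ (δ / 16) := by
      calc (8 : ℝ) ^ L ≤ ((m : ℝ) ^ (δ / 16)) ^ L := pow_le_pow_left₀ (by norm_num) h8 L
        _ = X ^ (δ / 16) := rpow_natCast_swap hm0R _ _
    calc (p : ℝ) ≤ 8 ^ L * (m : ℝ) ^ L := h1.trans h2'
      _ ≤ X ^ (δ / 16) * X := mul_le_mul h3 hXdef.symm.le (by positivity) (by positivity)
      _ = X ^ (1 + δ / 16) := by rw [add_comm, Real.rpow_add_one hX0.ne']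
  -- hence `p ^ (1/(2+δ)) ≤ X ^ ((1 + δ/16)/(2+δ))`
  have hroot : (p : ℝ) ^ (1 / (2 + δ)) ≤ X ^ ((1 + δ / 16) / (2 + δ)) := by
    calc (p : ℝ) ^ (1 / (2 + δ)) ≤ (X ^ (1 + δ / 16)) ^ (1 / (2 + δ)) :=
          Real.rpow_le_rpow (Nat.cast_nonneg _) hpX (by positivity)
      _ = X ^ ((1 + δ / 16) / (2 + δ)) := by rw [← Real.rpow_mul hX0.le, mul_one_div]
  -- the number of pairs kept
  set n₁ : ℕ := ⌈(p : ℝ) ^ (1 / (2 + δ))⌉₊ with hn₁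
  have hn₁X : (n₁ : ℝ) ≤ X ^ (1 / 2 - δ / 16) := by
    have h1 : (n₁ : ℝ) < (p : ℝ) ^ (1 / (2 + δ)) + 1 :=
      Nat.ceil_lt_add_one (Real.rpow_nonneg (Nat.cast_nonneg _) _)
    have h1' : (1 : ℝ) ≤ X ^ ((1 + δ / 16) / (2 + δ)) := Real.one_le_rpow hX1 (by positivity)
    have h2X : (2 : ℝ) ≤ X ^ (1 / 2 - δ / 16 - (1 + δ / 16) / (2 + δ)) := h2.trans (hmono hgap.le)
    calc (n₁ : ℝ) ≤ 2 * X ^ ((1 + δ / 16) / (2 + δ)) := by linarith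
      _ ≤ X ^ (1 / 2 - δ / 16 - (1 + δ / 16) / (2 + δ)) * X ^ ((1 + δ / 16) / (2 + δ)) :=
          mul_le_mul_of_nonneg_right h2X (by positivity)
      _ = X ^ (1 / 2 - δ / 16) := by rw [← Real.rpow_add hX0, sub_add_cancel]
  have hn₀X : (n₀ : ℝ) ≤ X ^ (1 / 2 - δ / 16) := hn₀.trans (hmono (by linarith))
  have hnX : ((max n₀ n₁ : ℕ) : ℝ) ≤ X ^ (1 / 2 - δ / 16) := by
    rw [Nat.cast_max]
    exact max_le hn₀X hn₁X
  refine ⟨max n₀ n₁, le_max_left _ _, ?_, ?_, ?_⟩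
  · -- `n ≤ N`
    exact_mod_cast hnX.trans hN
  · -- `p ≤ n ^ (2+δ)`
    have hXn : (p : ℝ) ^ (1 / (2 + δ)) ≤ ((max n₀ n₁ : ℕ) : ℝ) :=
      (Nat.le_ceil _).trans (by exact_mod_cast le_max_right n₀ n₁)
    calc (p : ℝ) = ((p : ℝ) ^ (1 / (2 + δ))) ^ (2 + δ) := by
          rw [← Real.rpow_mul (Nat.cast_nonneg _), one_div_mul_cancel h2δ.ne', Real.rpow_one]
      _ ≤ ((max n₀ n₁ : ℕ) : ℝ) ^ (2 + δ) :=
          Real.rpow_le_rpow (Real.rpow_nonneg (Nat.cast_nonneg _) _) hXn h2δ.le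
  · -- `n ^ (2-δ) ≤ (m ^ (1-δ/16)) ^ L`
    calc ((max n₀ n₁ : ℕ) : ℝ) ^ (2 - δ) ≤ (X ^ (1 / 2 - δ / 16)) ^ (2 - δ) :=
          Real.rpow_le_rpow (Nat.cast_nonneg _) hnX (by linarith)
      _ = X ^ ((1 / 2 - δ / 16) * (2 - δ)) := (Real.rpow_mul hX0.le _ _).symm
      _ ≤ X ^ (1 - δ / 16) := Real.rpow_le_rpow_of_exponent_le hX1 hexp₂
      _ = ((m : ℝ) ^ (1 - δ / 16)) ^ L := (rpow_natCast_swap hm0R _ _).symm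

/-! ## The registered stub -/

/-- **Stub `stub_capacityTransfer`: capacity gadgets give every slice `0 < δ ≤ 1` of the crux.**
If for every `ε > 0` there are arbitrarily large `m`, a gadget of direct pairs `(P c, Q c)_{c<r}` in
`ℤ/m` of co-volume `|P c||Q c| ≥ m^{1-ε}`, and a zero-error code `W` of words `Fin L → Fin r`
(`L ≥ 1`, every ordered pair of distinct words strongly separated in some coordinate) of size
`|W| ≥ (m^L)^{1/2-ε}`, then `PrimeTwoFamiliesAt δ`: arbitrarily large `n`, a prime `p ≤ n^{2+δ}` and
`n` SDPP pairs in `ℤ/p` with `|A i||B i| ≥ n^{2-δ}`.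

Proof (Mathlib API route): take `ε := δ/16` and a level `m` beyond the `atTop`-threshold of
`bookkeeping` (and `m ≥ 1`); enumerate `W` by `Fin |W|` (`Finset.equivFin`) and lift the code to
`|W|` SDPP blocks in `Fin L → ℤ/m` (`lift_direct`, `lift_cross`) of co-volume
`∏ₜ |P (w t)||Q (w t)| ≥ (m^{1-ε})^L`; move them into a Bertrand prime `p ≤ 4 (2m)^L` with block sizes
kept (`transfer`: base-`2m` digits reduced mod `p`); keep the first `n` blocks (`Fin.castLE`),
`n` from `bookkeeping`. -/
theorem stub_capacityTransfer
    (h : ∀ ε : ℝ, 0 < ε → ∀ m₀ : ℕ, ∃ m ≥ m₀, ∃ r L : ℕ, ∃ P Q : Fin r → Finset (ZMod m),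
      ∃ W : Finset (Fin L → Fin r),
        (∀ c : Fin r, ∀ x ∈ P c, ∀ x' ∈ P c, ∀ y ∈ Q c, ∀ y' ∈ Q c,
            (x - x') + (y - y') = 0 → x = x' ∧ y = y') ∧
        (∀ i ∈ W, ∀ k ∈ W, i ≠ k → ∃ t : Fin L,
            ∀ x ∈ P (i t), ∀ y ∈ Q (k t), ∀ c : Fin r, ∀ x' ∈ P c, ∀ y' ∈ Q c, y - x ≠ y' - x') ∧
        1 ≤ L ∧ ((m : ℝ) ^ (L : ℝ)) ^ (1 / 2 - ε) ≤ (W.card : ℝ) ∧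
        ∀ c : Fin r, (m : ℝ) ^ (1 - ε) ≤ (((P c).card * (Q c).card : ℕ) : ℝ))
    {δ : ℝ} (hδ : 0 < δ) (hδ1 : δ ≤ 1) : PrimeTwoFamiliesAt δ := by
  classical
  intro n₀
  -- a level `m` beyond the bookkeeping threshold, with its gadget and code
  obtain ⟨m₀, hm₀⟩ := eventually_atTop.1 ((bookkeeping hδ hδ1 n₀).and (eventually_ge_atTop 1))
  obtain ⟨m, hm, r, L, P, Q, W, hD, hC, hL, hWcard, hPQ⟩ := h (δ / 16) (by positivity) m₀
  obtain ⟨hbook, hm1⟩ := hm₀ m hm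
  haveI : NeZero m := ⟨by omega⟩
  -- enumerate the code by `Fin N`
  set N : ℕ := W.card with hN
  let e : W ≃ Fin N := W.equivFin
  let w : Fin N → Fin L → Fin r := fun i => ((e.symm i : W) : Fin L → Fin r)
  have hw : ∀ i, w i ∈ W := fun i => (e.symm i).2
  have hwinj : Function.Injective w := fun i j hij => e.symm.injective (Subtype.ext hij)
  -- the lifted family in `Fin L → ℤ/m`
  let A : Fin N → Finset (Fin L → ZMod m) := fun i => Fintype.piFinset fun t => P (w i t)
  let B : Fin N → Finset (Fin L → ZMod m) := fun i => Fintype.piFinset fun t => Q (w i t)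
  have hWA : ∀ i : Fin N, ∀ a ∈ A i, ∀ a' ∈ A i, ∀ b ∈ B i, ∀ b' ∈ B i,
      (a - a') + (b - b') = 0 → a = a' ∧ b = b' :=
    fun i => lift_direct hD (w i)
  have hXA : ∀ i j k : Fin N, ∀ a ∈ A i, ∀ a' ∈ A j, ∀ b ∈ B j, ∀ b' ∈ B k,
      (a - a') + (b - b') = 0 → i = k :=
    fun i j k a ha a' ha' b hb b' hb' h0 =>
      hwinj (lift_cross hC (hw i) (hw k) (w j) a ha a' ha' b hb b' hb' h0)
  -- transfer into a prime cyclic host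
  obtain ⟨p, hp, hple, A', B', hcard, hW', hX'⟩ := transfer hWA hXA
  -- the number of pairs kept
  obtain ⟨n, hn₀, hnN, hpn, hnco⟩ := hbook L hL N hWcard p hple
  refine ⟨n, hn₀, p, hp, A' ∘ Fin.castLE hnN, B' ∘ Fin.castLE hnN, ?_, ?_, hpn, ?_⟩
  · intro i
    exact hW' (Fin.castLE hnN i)
  · intro i j k a ha a' ha' b hb b' hb' h0
    exact Fin.castLE_injective hnN (hX' _ _ _ a ha a' ha' b hb b' hb' h0)
  · intro i
    obtain ⟨hcA, hcB⟩ := hcard (Fin.castLE hnN i)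
    simp only [Function.comp_apply]
    rw [hcA, hcB]
    simp only [A, B, Fintype.card_piFinset]
    rw [← Finset.prod_mul_distrib]
    refine hnco.trans ?_
    rw [← Fin.prod_const]
    push_cast
    exact Finset.prod_le_prod (fun t _ => by positivity) fun t _ => by exact_mod_cast hPQ _

end Summit.MatrixMultiplication.MatrixMultiplication.Theorems.PrimeTwoFamilies.CapacityTransferK5
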